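import Mathlib
import Summits.ResolutionOfSingularities.ResolutionOfSingularities.Theorems.SyzygyFlatteningDefs
import Literature.AlgebraicGeometry.Resolution.ZariskiClosedPoints
import HarnessLib

/-!
# Closed points of `Zar(K/k)` are dimension-zero valuation rings (`stub_closedPointDimZero`)

Crux `SyzygyFlattening.Globalisation` (stmt-ResolutionOfSingularities-17061), line `birth`,
registered stub `stub_closedPointDimZero` — PROVED: a closed point `v` of the Zariski–Riemann
space `Zar(K/k)` of a field extension `K/k` is a DIMENSION-ZERO valuation ring in the sense of
the route (`DimZero k 𝒪_v`: every `y ∈ 𝒪_v` satisfies `v(f(y)) < 1` for some non-zero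
`f ∈ k[X]`, i.e. the residue field `κ(v)` is algebraic over `k`).

Proof: by `ZariskiRiemannSpace.isClosed_singleton_iff_isIntegral` (Zariski–Samuel II, Ch. VI
§17, Thm. 38, in the tree) `{v}` closed means that `κ(v)` is integral over `k` through
`k → 𝒪_v → κ(v)`; a monic `f ∈ k[X]` killing the residue `ȳ` of `y ∈ 𝒪_v` has
`f(y) ∈ 𝔪_v` (push `f` through the residue map, a ring homomorphism), i.e. `v(f(y)) < 1`
(Mathlib `ValuationSubring.valuation_lt_one_iff`), and `f ≠ 0` since it is monic.

The converse (dimension zero ⇒ closed) is not needed by the skeleton and is not stated here.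
-/

noncomputable section

-- single-problem summit: the doubled namespace component `ResolutionOfSingularities` is forced
set_option linter.dupNamespace false

namespace Summit.ResolutionOfSingularities.ResolutionOfSingularities.Theorems.SyzygyFlattening

open Literature.AlgebraicGeometry.Resolution

/-- For a point `v` of `Zar(K/A)`, `x ∈ 𝒪_v` and `p ∈ A[X]`: `v(p(x)) < 1` iff the image `p̄` of
`p` under `A → κ(v)` vanishes at the residue `x̄` (`p(x) ∈ 𝔪_v ↔ p̄(x̄) = 0`, the residue map
being a ring homomorphism). [folklore] -/
theorem closedPointDimZero_valuation_eval₂_lt_one_iff {A K : Type*} [CommRing A] [Field K]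
    [Algebra A K] (v : ZariskiRiemannSpace A K) (p : Polynomial A) (x : v.asValuationSubring) :
    v.asValuationSubring.valuation (p.eval₂ (algebraMap A K) x) < 1 ↔
      p.eval₂ v.residueHom (IsLocalRing.residue v.asValuationSubring x) = 0 := by
  have h1 : ((p.eval₂ v.algebraMapHom x : v.asValuationSubring) : K) =
      p.eval₂ (algebraMap A K) (x : K) := by
    rw [show ((p.eval₂ v.algebraMapHom x : v.asValuationSubring) : K) =
        v.asValuationSubring.subtype (p.eval₂ v.algebraMapHom x) from rfl, Polynomial.hom_eval₂]
    rfl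
  have h2 : IsLocalRing.residue v.asValuationSubring (p.eval₂ v.algebraMapHom x) =
      p.eval₂ v.residueHom (IsLocalRing.residue v.asValuationSubring x) :=
    Polynomial.hom_eval₂ p v.algebraMapHom (IsLocalRing.residue v.asValuationSubring) x
  rw [← h1, ← h2, ← ValuationSubring.valuation_lt_one_iff, IsLocalRing.residue_eq_zero_iff]

/-- **STUB `stub_closedPointDimZero`.** A closed point `v` of `Zar(K/k)` is a dimension-zero
valuation ring: its residue field is integral over `k`
(`ZariskiRiemannSpace.isClosed_singleton_iff_isIntegral`), so every `y ∈ 𝒪_v` has a monic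
(hence non-zero) `f ∈ k[X]` with `f(ȳ) = 0`, i.e. `f(y) ∈ 𝔪_v`, i.e. `v(f(y)) < 1`.
[cite: ZariskiSamuel1960, Ch. VI §17, Thm. 38] -/
theorem stub_closedPointDimZero : ∀ (k K : Type) [Field k] [Field K] [Algebra k K]
    (v : ZariskiRiemannSpace k K), IsClosed ({v} : Set (ZariskiRiemannSpace k K)) →
      DimZero k v.asValuationSubring := by
  intro k K _ _ _ v hv y hy
  obtain ⟨f, hfm, hf⟩ := (ZariskiRiemannSpace.isClosed_singleton_iff_isIntegral.mp hv)
    (IsLocalRing.residue v.asValuationSubring ⟨y, hy⟩)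
  refine ⟨f, hfm.ne_zero, ?_⟩
  rw [Polynomial.aeval_def]
  exact (closedPointDimZero_valuation_eval₂_lt_one_iff v f ⟨y, hy⟩).mpr hf

end Summit.ResolutionOfSingularities.ResolutionOfSingularities.Theorems.SyzygyFlattening

end
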